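import Literature.Computability.AlgebraicComplexity.AndrewsForbes2022DeterminantalIdeals
import Literature.Computability.AlgebraicComplexity.BideterminantReductionProofs

/-!
# Andrews–Forbes 2022, Prop. 4.2 (Pfaffian reduction) — support file 1: the skew ↔ square dictionary

Toolkit (definitions with bodies + proved lemmas, NO named facts) for the proof of
`AndrewsForbes2022_prop_4_2` (`AndrewsForbes2022DeterminantalIdeals.lean`; AF22 Prop. 4.2, p0026:L23)
along the tree's highest-weight route for Prop. 3.5 (`BideterminantReductionProofs.lean`), now for
the congruence action `X ↦ A X Aᵀ` of `GL_N(𝔽)` on the generic skew-symmetric `N × N` matrix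
`X = skewX` (variables `x_{ij}`, `i < j`):

* `evS M` — evaluation of a skew polynomial at (the upper entries of) a matrix `M`;
  `translS A f = f(A X Aᵀ)` (= the statement's `skewCongr A f` over `𝔽`).
* `rho : 𝔽[x_{ij} : i<j] → 𝔽[Y]` (`Y` the generic `N × N` matrix), `x_{ij} ↦ y_{ij} - y_{ji}`, i.e.
  `f ↦ f(Y - Yᵀ)`: an INJECTIVE algebra map, EQUIVARIANT for the congruence action
  (`rho (translS A f) = transl A Aᵀ (rho f)` with the tree's two-sided translate `transl`), through
  which the tree's torus-family / filtered-substitution / unitriangular machinery on `𝔽[Y]`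
  (`BideterminantReductionWeights.lean`) is reused verbatim.
* symmetric digit weights `b^i + b^j` on both sides (`sdwt`, `sdwtS`), the index multiplicity
  `smult e i` of a skew exponent (`= rowWt + colWt` of its square image), digit separation.
* `rho` is graded: it maps `sdwtS`-homogeneous polynomials to `sdwt`-homogeneous ones of the same
  weight, hence commutes with taking weight components (`rho_weightedHomogeneousComponent`).
* congruence invariance at `𝔽`-points is a polynomial identity (`ev_congr_eq_of_forall`, the
  analogue of the tree's `ev_lower_mul_mul_upper_eq_of_forall`).

## References
* [AndrewsForbes2022] R. Andrews, M. A. Forbes, arXiv:2112.00792, §4.1 (Lemma 4.1, Prop. 4.2,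
  p0025–p0026) — the statement served; the highest-weight route replaces its straightening
  bookkeeping exactly as `BideterminantReductionProofs.lean` does for Prop. 3.5.
-/

noncomputable section

namespace Literature.Computability.AlgebraicComplexity

namespace PfaffianReduction

open MvPolynomial Matrix AndrewsForbes

variable {F : Type*} [Field F] {N : ℕ}

/-! ### Evaluation of skew polynomials at matrices -/

section EvS

variable {S' : Type*} [CommRing S'] [Algebra F S']

/-- Evaluation `f ↦ f(M)` of a polynomial in the variables `x_{ij}` (`i < j`) of the generic
skew-symmetric matrix at a matrix `M` with entries in a commutative `𝔽`-algebra: `x_{ij} ↦ M_{ij}`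
(only the upper entries of `M` are read). [folklore] -/
def evS (M : Matrix (Fin N) (Fin N) S') : MvPolynomial (SkewVarIdx N) F →ₐ[F] S' :=
  MvPolynomial.aeval fun p => M p.1.1 p.1.2

/-- `evS M (x_p) = M_p`. (proof plumbing for Prop. 4.2) [cite: AndrewsForbes2022, Prop. 4.2 (proof)] -/
@[simp] theorem evS_X (M : Matrix (Fin N) (Fin N) S') (p : SkewVarIdx N) :
    evS (F := F) M (X p) = M p.1.1 p.1.2 := by
  simp [evS]

/-- `evS M (C a) = a`. (proof plumbing for Prop. 4.2) [cite: AndrewsForbes2022, Prop. 4.2 (proof)] -/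
@[simp] theorem evS_C (M : Matrix (Fin N) (Fin N) S') (a : F) : evS M (C a) = algebraMap F S' a := by
  simp [evS]

/-- **Naturality**: an algebra map after `evS M` is `evS` at the mapped matrix.
(proof plumbing for Prop. 4.2) [cite: AndrewsForbes2022, Prop. 4.2 (proof)] -/
theorem map_evS {S'' : Type*} [CommRing S''] [Algebra F S''] (ψ : S' →ₐ[F] S'')
    (M : Matrix (Fin N) (Fin N) S') (f : MvPolynomial (SkewVarIdx N) F) :
    ψ (evS M f) = evS (M.map ψ) f := by
  have h := MvPolynomial.comp_aeval (R := F) ψ (f := fun p : SkewVarIdx N => M p.1.1 p.1.2)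
  have := congrArg (fun φ => φ f) h
  simpa [evS] using this

/-- The generic skew matrix mapped by `evS M` is `M`, for `M` alternating.
(proof plumbing for Prop. 4.2) [cite: AndrewsForbes2022, Prop. 4.2 (proof)] -/
theorem skewX_map_evS (M : Matrix (Fin N) (Fin N) S') (hM : Mᵀ = -M) (hd : ∀ i, M i i = 0) :
    (skewX F N).map (evS M) = M := by
  ext i j
  simp only [Matrix.map_apply, skewX, Matrix.of_apply]
  by_cases h1 : i < j
  · simp [h1]
  · by_cases h2 : j < i
    · simp only [h1, h2, dif_neg, not_false_eq_true, dif_pos, map_neg, evS_X]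
      have := congrFun (congrFun hM i) j
      simp only [transpose_apply, Matrix.neg_apply] at this
      rw [this, neg_neg]
    · have hij : i = j := le_antisymm (not_lt.mp h2) (not_lt.mp h1)
      subst hij
      simp [hd]

/-- Evaluation at the generic skew matrix is the identity.
(proof plumbing for Prop. 4.2) [cite: AndrewsForbes2022, Prop. 4.2 (proof)] -/
@[simp] theorem evS_skewX (f : MvPolynomial (SkewVarIdx N) F) : evS (skewX F N) f = f := by
  have : evS (F := F) (skewX F N) = AlgHom.id F _ := by
    refine MvPolynomial.algHom_ext fun p => ?_
    rw [evS_X, AlgHom.id_apply]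
    simp [skewX, p.2]
  rw [this, AlgHom.id_apply]

/-- The upper-triangular part of a matrix (entries strictly above the diagonal). [folklore] -/
def upperPart (M : Matrix (Fin N) (Fin N) S') : Matrix (Fin N) (Fin N) S' :=
  Matrix.of fun i j => if i < j then M i j else 0

/-- An alternating matrix is the upper part minus its transpose.
(proof plumbing for Prop. 4.2) [cite: AndrewsForbes2022, Prop. 4.2 (proof)] -/
theorem upperPart_sub_transpose (M : Matrix (Fin N) (Fin N) S') (hM : Mᵀ = -M) (hd : ∀ i, M i i = 0) :
    upperPart M - (upperPart M)ᵀ = M := by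
  ext i j
  simp only [upperPart, Matrix.sub_apply, Matrix.of_apply, transpose_apply]
  by_cases h1 : i < j
  · simp [h1, lt_asymm h1]
  · by_cases h2 : j < i
    · simp only [h1, h2, if_false, if_true, zero_sub]
      have := congrFun (congrFun hM i) j
      simp only [transpose_apply, Matrix.neg_apply] at this
      rw [this, neg_neg]
    · have hij : i = j := le_antisymm (not_lt.mp h2) (not_lt.mp h1)
      subst hij
      simp [hd]

/-- `evS` only reads upper entries. (proof plumbing for Prop. 4.2) [cite: AndrewsForbes2022, Prop. 4.2 (proof)] -/
theorem evS_upperPart (M : Matrix (Fin N) (Fin N) S') (f : MvPolynomial (SkewVarIdx N) F) :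
    evS (upperPart M) f = evS M f := by
  unfold evS
  exact congrArg (fun g => MvPolynomial.aeval g f) (funext fun p => by simp [upperPart, p.2])

/-- Congruence preserves alternating matrices: transpose (AF22 §2.6: `A X Aᵀ` is again
skew-symmetric). [cite: AndrewsForbes2022, §2.6] -/
theorem transpose_mul_mul_transpose_of_alt {ι κ : Type*} [Fintype ι] [Fintype κ]
    (P : Matrix κ ι S') (M : Matrix ι ι S') (hM : Mᵀ = -M) : (P * M * Pᵀ)ᵀ = -(P * M * Pᵀ) := by
  rw [transpose_mul, transpose_mul, transpose_transpose, hM, Matrix.neg_mul, Matrix.mul_neg,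
    Matrix.mul_assoc]

/-- Congruence preserves alternating matrices: zero diagonal (characteristic-free: the summands
pair off; AF22 §2.6). [cite: AndrewsForbes2022, §2.6] -/
theorem mul_mul_transpose_apply_self_of_alt {ι κ : Type*} [Fintype ι] [DecidableEq ι] [Fintype κ]
    (P : Matrix κ ι S') (M : Matrix ι ι S') (hM : Mᵀ = -M) (hd : ∀ i, M i i = 0) (a : κ) :
    (P * M * Pᵀ) a a = 0 := by
  have halt : ∀ x y, M y x = -M x y := fun x y => by
    simpa using congrFun (congrFun hM x) y
  rw [Matrix.mul_apply]
  simp_rw [Matrix.mul_apply, transpose_apply, Finset.sum_mul]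
  rw [← Finset.sum_product']
  refine Finset.sum_involution (fun p _ => (p.2, p.1)) ?_ ?_ ?_ ?_
  · rintro ⟨x, y⟩ _
    simp only [halt x y]
    ring
  · rintro ⟨x, y⟩ _ hne h
    simp only [Prod.mk.injEq] at h
    apply hne
    simp only [h.1, hd, mul_zero, zero_mul]
  · rintro ⟨x, y⟩ _
    simp
  · rintro ⟨x, y⟩ _
    rfl

end EvS

/-! ### The embedding `ρ : f ↦ f(Y - Yᵀ)` and the congruence translates -/

section Rho

variable {S' : Type*} [CommRing S'] [Algebra F S']

/-- **`ρ(f) = f(Y - Yᵀ)`**: the skew polynomial `f` evaluated at the alternating matrix `Y - Yᵀ`,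
`Y` the generic `N × N` matrix — an algebra map `𝔽[x_{ij} : i<j] → 𝔽[Y]`. [folklore] -/
def rho : MvPolynomial (SkewVarIdx N) F →ₐ[F] MvPolynomial (Fin N × Fin N) F :=
  evS (mvPolynomialX (Fin N) (Fin N) F - (mvPolynomialX (Fin N) (Fin N) F)ᵀ)

/-- `ρ(x_{ij}) = y_{ij} - y_{ji}`. (proof plumbing for Prop. 4.2) [cite: AndrewsForbes2022, Prop. 4.2 (proof)] -/
theorem rho_X (p : SkewVarIdx N) :
    rho (F := F) (X p) = X (p.1.1, p.1.2) - X (p.1.2, p.1.1) := by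
  rw [rho, evS_X]
  simp [mvPolynomialX_apply]

/-- **Evaluating `ρ f` at `M` is evaluating `f` at `M - Mᵀ`.**
(proof plumbing for Prop. 4.2) [cite: AndrewsForbes2022, Prop. 4.2 (proof)] -/
theorem ev_rho (M : Matrix (Fin N) (Fin N) S') (f : MvPolynomial (SkewVarIdx N) F) :
    ev M (rho f) = evS (M - Mᵀ) f := by
  rw [rho, map_evS]
  congr 1
  rw [Matrix.map_sub _ (map_sub (ev M)), Matrix.transpose_map, mvPolynomialX_map_ev]

/-- At the upper part of an alternating `M`, `ρ f` evaluates to `f(M)`.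
(proof plumbing for Prop. 4.2) [cite: AndrewsForbes2022, Prop. 4.2 (proof)] -/
theorem ev_upperPart_rho (M : Matrix (Fin N) (Fin N) S') (hM : Mᵀ = -M) (hd : ∀ i, M i i = 0)
    (f : MvPolynomial (SkewVarIdx N) F) : ev (upperPart M) (rho f) = evS M f := by
  rw [ev_rho, upperPart_sub_transpose M hM hd]

/-- The diagonal of the generic skew matrix vanishes. [cite: AndrewsForbes2022, §2.6] -/
theorem skewX_apply_self (i : Fin N) : skewX F N i i = 0 := by
  simp [skewX]

/-- `ρ` has the left inverse "evaluate at the upper part of the generic skew matrix"; in particular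
it is injective. (proof plumbing for Prop. 4.2) [cite: AndrewsForbes2022, Prop. 4.2 (proof)] -/
theorem ev_upperPart_skewX_rho (f : MvPolynomial (SkewVarIdx N) F) :
    ev (upperPart (skewX F N)) (rho f) = f := by
  rw [ev_upperPart_rho _ (skewX_transpose N) skewX_apply_self, evS_skewX]

/-- `ρ` is injective. (proof plumbing for Prop. 4.2) [cite: AndrewsForbes2022, Prop. 4.2 (proof)] -/
theorem rho_injective : Function.Injective (rho (F := F) (N := N)) := fun f g h => by
  rw [← ev_upperPart_skewX_rho f, ← ev_upperPart_skewX_rho g, h]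

/-- The congruence translate `f ↦ f(A X Aᵀ)` by a numerical matrix `A` — the statement's
`skewCongr A` over the ground field. [cite: AndrewsForbes2022, Prop. 4.2 (proof, last paragraph)] -/
def translS (A : Matrix (Fin N) (Fin N) F) :
    MvPolynomial (SkewVarIdx N) F →ₐ[F] MvPolynomial (SkewVarIdx N) F :=
  evS ((A.map C : Matrix (Fin N) (Fin N) (MvPolynomial (SkewVarIdx N) F)) * skewX F N *
    (A.map C : Matrix (Fin N) (Fin N) (MvPolynomial (SkewVarIdx N) F))ᵀ)

/-- `translS A f` IS `skewCongr A f`. [cite: AndrewsForbes2022, Prop. 4.2 (proof, last paragraph)] -/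
theorem translS_eq_skewCongr (A : Matrix (Fin N) (Fin N) F) (f : MvPolynomial (SkewVarIdx N) F) :
    translS A f = skewCongr A f := rfl

/-- Evaluating a translate: `(f(AXAᵀ))(M) = f(A M Aᵀ)` for `M` alternating.
(proof plumbing for Prop. 4.2) [cite: AndrewsForbes2022, Prop. 4.2 (proof)] -/
theorem evS_translS (M : Matrix (Fin N) (Fin N) S') (hM : Mᵀ = -M) (hd : ∀ i, M i i = 0)
    (A : Matrix (Fin N) (Fin N) F) (f : MvPolynomial (SkewVarIdx N) F) :
    evS M (translS A f) = evS (A.map (algebraMap F S') * M * (A.map (algebraMap F S'))ᵀ) f := by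
  rw [translS, map_evS]
  congr 1
  have hA : (A.map (C : F → MvPolynomial (SkewVarIdx N) F)).map (evS M) = A.map (algebraMap F S') := by
    ext i j; simp
  rw [map_mul_mul, skewX_map_evS M hM hd, transpose_map, hA]

/-- **Equivariance of `ρ`**: `ρ(f(A X Aᵀ)) = (ρ f)(A Y Aᵀ)`.
(proof plumbing for Prop. 4.2) [cite: AndrewsForbes2022, Prop. 4.2 (proof)] -/
theorem rho_translS (A : Matrix (Fin N) (Fin N) F) (f : MvPolynomial (SkewVarIdx N) F) :
    rho (translS A f) = transl A Aᵀ (rho f) := by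
  rw [transl_apply, ev_rho, translS, map_evS]
  congr 1
  rw [map_mul_mul, transpose_map]
  have hC : (A.map (C : F → MvPolynomial (SkewVarIdx N) F)).map (rho (F := F) (N := N)) =
      A.map (C : F → MvPolynomial (Fin N × Fin N) F) := by
    ext i j; simp [MvPolynomial.algHom_C]
  have hX : (skewX F N).map (rho (F := F) (N := N)) =
      mvPolynomialX (Fin N) (Fin N) F - (mvPolynomialX (Fin N) (Fin N) F)ᵀ := by
    ext i j
    simp only [Matrix.map_apply, skewX, Matrix.of_apply, Matrix.sub_apply, transpose_apply,
      mvPolynomialX_apply]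
    by_cases h1 : i < j
    · simp [h1, rho_X]
    · by_cases h2 : j < i
      · simp [h1, h2, rho_X]
      · obtain rfl : i = j := le_antisymm (not_lt.mp h2) (not_lt.mp h1)
        simp
  rw [hC, hX, Matrix.transpose_map]
  simp only [Matrix.mul_sub, Matrix.sub_mul, Matrix.transpose_mul, Matrix.transpose_transpose,
    Matrix.mul_assoc]

end Rho


/-! ### Symmetric digit weights and index multiplicities -/

section Weights

/-- The symmetric digit weight `w(i,j) = b^i + b^j` on the variables `y_{ij}` of the generic square
matrix (the torus `Y ↦ D Y D`, `D = diag(t^{b^i})`). [cite: AndrewsForbes2022, Prop. 4.2 (proof)] -/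
def sdwt (N b : ℕ) : Fin N × Fin N → ℕ := fun ij => b ^ (ij.1 : ℕ) + b ^ (ij.2 : ℕ)

/-- `sdwt` has the shape `u_i + v_j` with `u = v`. (proof plumbing) [cite: AndrewsForbes2022, Prop. 4.2 (proof)] -/
theorem sdwt_eq (b : ℕ) :
    sdwt N b = fun ij : Fin N × Fin N => b ^ (ij.1 : ℕ) + b ^ (ij.2 : ℕ) :=
  rfl

/-- The same weight on the skew variables `x_{ij}`, `i < j`. [cite: AndrewsForbes2022, Prop. 4.2 (proof)] -/
def sdwtS (N b : ℕ) : SkewVarIdx N → ℕ := fun p => b ^ (p.1.1 : ℕ) + b ^ (p.1.2 : ℕ)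

/-- The **index multiplicity** of a skew exponent `e` at `i`: how often the index `i` occurs among
the variables of `x^e` (the torus weight of `x^e` for `X ↦ D X D`). [cite: AndrewsForbes2022, Prop. 4.2 (proof)] -/
def smult (e : SkewVarIdx N →₀ ℕ) (i : Fin N) : ℕ :=
  (∑ p : SkewVarIdx N, if p.1.1 = i then e p else 0) + ∑ p : SkewVarIdx N, if p.1.2 = i then e p else 0

/-- The skew digit weight is `∑_i smult_i · b^i`. (proof plumbing) [cite: AndrewsForbes2022, Prop. 4.2 (proof)] -/
theorem weight_sdwtS (b : ℕ) (e : SkewVarIdx N →₀ ℕ) :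
    Finsupp.weight (sdwtS N b) e = ∑ i, smult e i * b ^ (i : ℕ) := by
  rw [Finsupp.weight_apply, Finsupp.sum_fintype _ _ (by simp)]
  simp only [sdwtS, smul_eq_mul, mul_add, Finset.sum_add_distrib, smult, add_mul, Finset.sum_mul]
  congr 1
  · rw [Finset.sum_comm]
    refine Finset.sum_congr rfl fun p _ => ?_
    simp only [ite_mul, zero_mul]
    rw [Finset.sum_ite_eq, if_pos (Finset.mem_univ _)]
  · rw [Finset.sum_comm]
    refine Finset.sum_congr rfl fun p _ => ?_
    simp only [ite_mul, zero_mul]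
    rw [Finset.sum_ite_eq, if_pos (Finset.mem_univ _)]

/-- The square digit weight is `∑_i (rowWt_i + colWt_i) · b^i`. (proof plumbing) [cite: AndrewsForbes2022, Prop. 4.2 (proof)] -/
theorem weight_sdwt (b : ℕ) (d : Fin N × Fin N →₀ ℕ) :
    Finsupp.weight (sdwt N b) d = ∑ i, (rowWt d i + colWt d i) * b ^ (i : ℕ) := by
  rw [sdwt_eq, weight_add_eq (fun i : Fin N => b ^ (i : ℕ)) (fun j : Fin N => b ^ (j : ℕ)) d]
  simp only [add_mul, Finset.sum_add_distrib]

/-- **Digits separate index multiplicities** (skew side). [cite: AndrewsForbes2022, Prop. 4.2 (proof)] -/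
theorem smult_eq_of_weight_eq {b : ℕ} (hb : 0 < b) {e e' : SkewVarIdx N →₀ ℕ}
    (he : ∀ i, smult e i < b) (he' : ∀ i, smult e' i < b)
    (h : Finsupp.weight (sdwtS N b) e = Finsupp.weight (sdwtS N b) e') : smult e = smult e' := by
  rw [weight_sdwtS, weight_sdwtS] at h
  exact digits_injective hb _ _ he he' h

/-- **Digits separate `rowWt + colWt`** (square side). [cite: AndrewsForbes2022, Prop. 4.2 (proof)] -/
theorem rowColWt_eq_of_weight_eq {b : ℕ} (hb : 0 < b) {d d' : Fin N × Fin N →₀ ℕ}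
    (hd : ∀ i, rowWt d i + colWt d i < b) (hd' : ∀ i, rowWt d' i + colWt d' i < b)
    (h : Finsupp.weight (sdwt N b) d = Finsupp.weight (sdwt N b) d') :
    (fun i => rowWt d i + colWt d i) = fun i => rowWt d' i + colWt d' i := by
  rw [weight_sdwt, weight_sdwt] at h
  exact digits_injective hb _ _ hd hd' h

/-- Mixed form: equal digit weights on the two sides give `smult e = rowWt d + colWt d`.
[cite: AndrewsForbes2022, Prop. 4.2 (proof)] -/
theorem smult_eq_rowColWt_of_weight_eq {b : ℕ} (hb : 0 < b) {e : SkewVarIdx N →₀ ℕ}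
    {d : Fin N × Fin N →₀ ℕ} (he : ∀ i, smult e i < b) (hd : ∀ i, rowWt d i + colWt d i < b)
    (h : Finsupp.weight (sdwtS N b) e = Finsupp.weight (sdwt N b) d) :
    smult e = fun i => rowWt d i + colWt d i := by
  rw [weight_sdwtS, weight_sdwt] at h
  exact digits_injective hb _ _ he hd h

/-- `smult e i ≤ deg x^e`. (proof plumbing) [cite: AndrewsForbes2022, Prop. 4.2 (proof)] -/
theorem smult_le_degree (e : SkewVarIdx N →₀ ℕ) (i : Fin N) : smult e i ≤ e.degree := by
  rw [smult, ← Finset.sum_add_distrib, Finsupp.degree_eq_sum,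
    ← Finsupp.sum_fintype e (fun _ k => k) (by simp), Finsupp.sum_fintype _ _ (by simp)]
  refine Finset.sum_le_sum fun p _ => ?_
  by_cases h1 : p.1.1 = i
  · have h2 : p.1.2 ≠ i := fun h2 => (lt_irrefl i) (by simpa [h1, h2] using p.2)
    simp [h1, h2]
  · by_cases h2 : p.1.2 = i
    · simp [h1, h2]
    · simp [h1, h2]

/-- `rowWt d i + colWt d i ≤ 2 · deg y^d`. (proof plumbing) [cite: AndrewsForbes2022, Prop. 4.2 (proof)] -/
theorem rowColWt_le_two_mul_degree (d : Fin N × Fin N →₀ ℕ) (i : Fin N) :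
    rowWt d i + colWt d i ≤ 2 * d.degree := by
  have := rowWt_le_degree d i
  have := colWt_le_degree d i
  omega

variable {S' : Type*} [CommRing S'] [Algebra F S']

/-- Linear substitutions do not raise the total degree (skew variables).
(proof plumbing) [cite: AndrewsForbes2022, Prop. 4.2 (proof)] -/
theorem totalDegree_evS_le {τ : Type*} (M : Matrix (Fin N) (Fin N) (MvPolynomial τ F))
    (hM : ∀ i j, (M i j).totalDegree ≤ 1) (f : MvPolynomial (SkewVarIdx N) F) :
    (evS M f).totalDegree ≤ f.totalDegree := by
  classical
  rw [evS, MvPolynomial.aeval_def, MvPolynomial.eval₂_eq]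
  refine (MvPolynomial.totalDegree_finsetSum _ _).trans (Finset.sup_le fun e he => ?_)
  refine (MvPolynomial.totalDegree_mul _ _).trans ?_
  rw [MvPolynomial.algebraMap_eq, MvPolynomial.totalDegree_C, zero_add]
  refine (MvPolynomial.totalDegree_finsetProd _ _).trans ?_
  refine le_trans (Finset.sum_le_sum fun p _ => (MvPolynomial.totalDegree_pow _ _).trans
    (Nat.mul_le_mul_left _ (hM p.1.1 p.1.2))) ?_
  simp only [mul_one]
  exact MvPolynomial.le_totalDegree he

/-- `deg ρ(f) ≤ deg f`. (proof plumbing) [cite: AndrewsForbes2022, Prop. 4.2 (proof)] -/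
theorem totalDegree_rho_le (f : MvPolynomial (SkewVarIdx N) F) : (rho f).totalDegree ≤ f.totalDegree := by
  refine totalDegree_evS_le _ (fun i j => ?_) f
  rw [Matrix.sub_apply, transpose_apply, mvPolynomialX_apply, mvPolynomialX_apply]
  refine (MvPolynomial.totalDegree_sub _ _).trans ?_
  rw [MvPolynomial.totalDegree_X, MvPolynomial.totalDegree_X, max_self]

end Weights

/-! ### `ρ` is graded -/

section Graded

/-- `ρ(x_p)` is homogeneous of weight `w(p)`. (proof plumbing) [cite: AndrewsForbes2022, Prop. 4.2 (proof)] -/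
theorem isWeightedHomogeneous_rho_X (b : ℕ) (p : SkewVarIdx N) :
    IsWeightedHomogeneous (sdwt N b) (rho (F := F) (X p)) (sdwtS N b p) := by
  rw [rho_X]
  have h1 : IsWeightedHomogeneous (sdwt N b) (X (p.1.1, p.1.2) : MvPolynomial (Fin N × Fin N) F)
      (sdwtS N b p) := isWeightedHomogeneous_X _ _ _
  have h2 : IsWeightedHomogeneous (sdwt N b) (X (p.1.2, p.1.1) : MvPolynomial (Fin N × Fin N) F)
      (sdwtS N b p) := by
    have := isWeightedHomogeneous_X (R := F) (sdwt N b) (p.1.2, p.1.1)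
    simp only [sdwt, sdwtS] at this ⊢
    rwa [add_comm] at this
  exact (weightedHomogeneousSubmodule F (sdwt N b) (sdwtS N b p)).sub_mem h1 h2

/-- `ρ(c · x^e)` is homogeneous of weight `⟨w, e⟩`. (proof plumbing) [cite: AndrewsForbes2022, Prop. 4.2 (proof)] -/
theorem isWeightedHomogeneous_rho_monomial (b : ℕ) (e : SkewVarIdx N →₀ ℕ) (c : F) :
    IsWeightedHomogeneous (sdwt N b) (rho (monomial e c)) (Finsupp.weight (sdwtS N b) e) := by
  classical
  rw [MvPolynomial.monomial_eq, map_mul, MvPolynomial.algHom_C, Finsupp.prod, map_prod,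
    Finsupp.weight_apply, Finsupp.sum]
  refine IsWeightedHomogeneous.C_mul ?_ c
  refine IsWeightedHomogeneous.prod _ _ _ fun p _ => ?_
  rw [map_pow]
  exact (isWeightedHomogeneous_rho_X b p).pow (e p)

/-- The weight component of a monomial. (proof plumbing) [cite: AndrewsForbes2022, Prop. 4.2 (proof)] -/
theorem weightedHomogeneousComponent_monomial' {σ : Type*} (w : σ → ℕ) (q : ℕ) (e : σ →₀ ℕ) (c : F) :
    weightedHomogeneousComponent w q (monomial e c) =
      if Finsupp.weight w e = q then monomial e c else 0 := by
  have h := isWeightedHomogeneous_monomial w e c rfl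
  split_ifs with hq
  · rw [← hq]; exact h.weightedHomogeneousComponent_same
  · exact h.weightedHomogeneousComponent_ne q (Ne.symm hq)

/-- **`ρ` commutes with taking weight components.** (proof plumbing) [cite: AndrewsForbes2022, Prop. 4.2 (proof)] -/
theorem rho_weightedHomogeneousComponent (b q : ℕ) (T : MvPolynomial (SkewVarIdx N) F) :
    rho (weightedHomogeneousComponent (sdwtS N b) q T) =
      weightedHomogeneousComponent (sdwt N b) q (rho T) := by
  classical
  conv_lhs => rw [T.as_sum]
  conv_rhs => rw [T.as_sum]
  simp only [map_sum]
  refine Finset.sum_congr rfl fun e _ => ?_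
  rw [weightedHomogeneousComponent_monomial']
  have h := isWeightedHomogeneous_rho_monomial (F := F) b e (coeff e T)
  split_ifs with hq
  · rw [← hq]; exact h.weightedHomogeneousComponent_same.symm
  · rw [map_zero]; exact (h.weightedHomogeneousComponent_ne q (Ne.symm hq)).symm

/-- The tree's torus-family coefficient is Mathlib's weight component.
(proof plumbing) [cite: AndrewsForbes2022, Prop. 4.2 (proof)] -/
theorem coeff_twist_eq_weightedHomogeneousComponent (w : Fin N × Fin N → ℕ) (q : ℕ)
    (p : MvPolynomial (Fin N × Fin N) F) : (twist w p).coeff q = weightedHomogeneousComponent w q p := by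
  classical
  ext d
  rw [coeff_coeff_twist, coeff_weightedHomogeneousComponent]

/-- Every monomial of `ρ T` has the digit weight of some monomial of `T`.
(proof plumbing) [cite: AndrewsForbes2022, Prop. 4.2 (proof)] -/
theorem exists_weight_eq_of_mem_support_rho (b : ℕ) (T : MvPolynomial (SkewVarIdx N) F)
    {d : Fin N × Fin N →₀ ℕ} (hd : d ∈ (rho T).support) :
    ∃ e ∈ T.support, Finsupp.weight (sdwt N b) d = Finsupp.weight (sdwtS N b) e := by
  classical
  have h : rho T = ∑ e ∈ T.support, rho (monomial e (coeff e T)) := by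
    conv_lhs => rw [T.as_sum]
    rw [map_sum]
  rw [h] at hd
  obtain ⟨e, he, hde⟩ := Finset.mem_biUnion.mp (MvPolynomial.support_sum hd)
  exact ⟨e, he, isWeightedHomogeneous_rho_monomial b e (coeff e T) (mem_support_iff.mp hde)⟩

/-- Monomials of a weight component have that weight. (proof plumbing) [cite: AndrewsForbes2022, Prop. 4.2 (proof)] -/
theorem weight_eq_of_mem_support_weightedHomogeneousComponent {σ : Type*} (w : σ → ℕ) (q : ℕ)
    (T : MvPolynomial σ F) {e : σ →₀ ℕ} (he : e ∈ (weightedHomogeneousComponent w q T).support) :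
    Finsupp.weight w e = q :=
  (weightedHomogeneousComponent_isWeightedHomogeneous (w := w) (n := q) (φ := T)) (mem_support_iff.mp he)

/-- The support of a weight component lies in the support. (proof plumbing) [cite: AndrewsForbes2022, Prop. 4.2 (proof)] -/
theorem mem_support_of_mem_support_weightedHomogeneousComponent {σ : Type*} (w : σ → ℕ) (q : ℕ)
    (T : MvPolynomial σ F) {e : σ →₀ ℕ} (he : e ∈ (weightedHomogeneousComponent w q T).support) :
    e ∈ T.support := by
  classical
  rw [mem_support_iff, coeff_weightedHomogeneousComponent] at he
  rw [mem_support_iff]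
  intro h; exact he (by simp [h])

end Graded

/-! ### Simultaneous row/column permutations -/

section Perm

/-- The congruence translate by a permutation matrix renames both indices.
(proof plumbing) [cite: AndrewsForbes2022, Prop. 4.2 (proof)] -/
theorem transl_perm (τ : Equiv.Perm (Fin N)) (p : MvPolynomial (Fin N × Fin N) F) :
    transl (τ.permMatrix F) (τ.permMatrix F)ᵀ p = rename (fun ij : Fin N × Fin N => (τ ij.1, τ ij.2)) p := by
  have : transl (τ.permMatrix F) (τ.permMatrix F)ᵀ =
      rename (fun ij : Fin N × Fin N => (τ ij.1, τ ij.2)) := by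
    refine MvPolynomial.algHom_ext fun ij => ?_
    obtain ⟨i, j⟩ := ij
    rw [rename_X, transl_apply, ev_X]
    simp only [Matrix.mul_apply, Matrix.map_apply, transpose_apply, mvPolynomialX_apply,
      Equiv.Perm.permMatrix, PEquiv.toMatrix_apply, Equiv.toPEquiv_apply, Option.mem_def,
      Option.some.injEq]
    rw [Finset.sum_eq_single (τ j)]
    · rw [Finset.sum_eq_single (τ i)]
      · simp
      · intro k _ hk
        rw [if_neg (Ne.symm hk), map_zero, zero_mul]
      · intro h; exact absurd (Finset.mem_univ _) h
    · intro l _ hl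
      rw [if_neg (Ne.symm hl), map_zero, mul_zero]
    · intro h; exact absurd (Finset.mem_univ _) h
  rw [this]

/-- Simultaneous renaming permutes `rowWt + colWt`. (proof plumbing) [cite: AndrewsForbes2022, Prop. 4.2 (proof)] -/
theorem rowColWt_mapDomain_perm (τ : Equiv.Perm (Fin N)) (d : Fin N × Fin N →₀ ℕ) (a : Fin N) :
    rowWt (Finsupp.mapDomain (fun ij : Fin N × Fin N => (τ ij.1, τ ij.2)) d) (τ a) +
      colWt (Finsupp.mapDomain (fun ij : Fin N × Fin N => (τ ij.1, τ ij.2)) d) (τ a) =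
      rowWt d a + colWt d a := by
  have hinj : Function.Injective (fun ij : Fin N × Fin N => (τ ij.1, τ ij.2)) := by
    intro x y hxy
    simp only [Prod.mk.injEq] at hxy
    exact Prod.ext (τ.injective hxy.1) (τ.injective hxy.2)
  simp only [rowWt, colWt]
  congr 1
  · calc ∑ j, (Finsupp.mapDomain (fun ij : Fin N × Fin N => (τ ij.1, τ ij.2)) d) (τ a, j)
        = ∑ j, (Finsupp.mapDomain (fun ij : Fin N × Fin N => (τ ij.1, τ ij.2)) d) (τ a, τ j) :=
          (Equiv.sum_comp τ (fun j => (Finsupp.mapDomain (fun ij : Fin N × Fin N => (τ ij.1, τ ij.2)) d) (τ a, j))).symm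
      _ = ∑ j, d (a, j) := Finset.sum_congr rfl fun j _ => Finsupp.mapDomain_apply hinj d (a, j)
  · calc ∑ i, (Finsupp.mapDomain (fun ij : Fin N × Fin N => (τ ij.1, τ ij.2)) d) (i, τ a)
        = ∑ i, (Finsupp.mapDomain (fun ij : Fin N × Fin N => (τ ij.1, τ ij.2)) d) (τ i, τ a) :=
          (Equiv.sum_comp τ (fun i => (Finsupp.mapDomain (fun ij : Fin N × Fin N => (τ ij.1, τ ij.2)) d) (i, τ a))).symm
      _ = ∑ i, d (i, a) := Finset.sum_congr rfl fun i _ => Finsupp.mapDomain_apply hinj d (i, a)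

end Perm

/-! ### Congruence invariance at `𝔽`-points is a polynomial identity -/

section Generic

/-- **Unitriangular congruence invariance is a polynomial identity.** If `f(L Y Lᵀ) = f(Y)` in
`𝔽[Y]` for all lower unitriangular `L ∈ Mat_N(𝔽)`, `𝔽` infinite, then `f(L M Lᵀ) = f(M)` for
lower unitriangular `L` and arbitrary `M` with entries in any commutative `𝔽`-algebra (the analogue
of the tree's `ev_lower_mul_mul_upper_eq_of_forall`). [cite: AndrewsForbes2022, Prop. 4.2 (proof)] -/
theorem ev_congr_eq_of_forall [Infinite F] (f : MvPolynomial (Fin N × Fin N) F)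
    (hf : ∀ (L : Matrix (Fin N) (Fin N) F), L.BlockTriangular OrderDual.toDual → (∀ i, L i i = 1) →
      ev ((L.map C : Matrix (Fin N) (Fin N) (MvPolynomial (Fin N × Fin N) F)) *
        mvPolynomialX (Fin N) (Fin N) F *
        (L.map C : Matrix (Fin N) (Fin N) (MvPolynomial (Fin N × Fin N) F))ᵀ) f = f)
    {S : Type*} [CommRing S] [Algebra F S]
    (L : Matrix (Fin N) (Fin N) S) (hL : L.BlockTriangular OrderDual.toDual) (hLd : ∀ i, L i i = 1)
    (M : Matrix (Fin N) (Fin N) S) : ev (L * M * Lᵀ) f = ev M f := by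
  classical
  let V := (Fin N × Fin N) ⊕ (Fin N × Fin N)
  let P := MvPolynomial V F
  let Λ : Matrix (Fin N) (Fin N) P := Matrix.of fun i k =>
    if k < i then X (Sum.inl (i, k)) else if k = i then 1 else 0
  let Y : Matrix (Fin N) (Fin N) P := Matrix.of fun i j => X (Sum.inr (i, j))
  let G : P := ev (Λ * Y * Λᵀ) f - ev Y f
  have hΛ : ∀ ψ : P →ₐ[F] F, (Λ.map ψ).BlockTriangular OrderDual.toDual ∧ (∀ i, Λ.map ψ i i = 1) := by
    intro ψ
    constructor
    · intro i k hik
      have hik' : i < k := hik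
      simp only [Λ, Matrix.map_apply, Matrix.of_apply, if_neg (not_lt.mpr hik'.le), if_neg hik'.ne',
        map_zero]
    · intro i
      simp [Λ]
  -- Step 1: `G` vanishes at every `𝔽`-point
  have hG0 : ∀ x : V → F, MvPolynomial.aeval x G = 0 := by
    intro x
    simp only [G, map_sub, map_ev]
    rw [map_mul_mul, Matrix.transpose_map]
    set Lx := Λ.map (MvPolynomial.aeval x : P →ₐ[F] F) with hLx
    set Yx := Y.map (MvPolynomial.aeval x : P →ₐ[F] F) with hYx
    have hpoly := hf Lx (hΛ _).1 (hΛ _).2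
    have := congrArg (ev Yx) hpoly
    rw [ev_ev, map_mul_mul, map_C_map_ev, Matrix.transpose_map, map_C_map_ev, mvPolynomialX_map_ev]
      at this
    simpa [Algebra.algebraMap_self, Matrix.map_id] using sub_eq_zero.mpr this
  -- Step 2: hence `G = 0`
  have hG : G = 0 := MvPolynomial.funext fun x => by
    rw [map_zero]
    exact hG0 x
  -- Step 3: specialise
  let pt : V → S := Sum.elim (fun ik => L ik.1 ik.2) fun ij => M ij.1 ij.2
  have hΛpt : Λ.map (MvPolynomial.aeval pt : P →ₐ[F] S) = L := by
    ext i k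
    simp only [Λ, Matrix.map_apply, Matrix.of_apply]
    by_cases hki : k < i
    · simp [hki, pt]
    · by_cases hki' : k = i
      · subst hki'
        simp [hLd]
      · have hik : i < k := lt_of_le_of_ne (not_lt.mp hki) (Ne.symm hki')
        rw [if_neg hki, if_neg hki', map_zero]
        exact (hL (show OrderDual.toDual k < OrderDual.toDual i from hik)).symm
  have hYpt : Y.map (MvPolynomial.aeval pt : P →ₐ[F] S) = M := by
    ext i j
    simp [Y, pt]
  have := congrArg (MvPolynomial.aeval pt : P →ₐ[F] S) hG
  rw [map_zero] at this
  simp only [G, map_sub, map_ev] at this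
  rw [map_mul_mul, Matrix.transpose_map, hΛpt, hYpt] at this
  exact sub_eq_zero.mp this

end Generic

end PfaffianReduction

end Literature.Computability.AlgebraicComplexity
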